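import Summits.QuantumFields.YangMills.Theorems.BalabanLadderNTLinkVarianceFloorPinch
import HarnessLib

/-!
# Crux `NT` (stmt-QuantumFields-19353): the one-link VARIANCE FLOOR — no consistent exterior freezes the
# FLUCTUATIONS of a link faster than `1/β` (hypothesis-free)

Fleet lead prover of crux `NT` (unit `ym-spine-19353-p1`, g30).  Sequel of `Theorems/BalabanLadderNTLinkEquipartition`
(g9's one-link equipartition floor for the MEAN) and `Theorems/BalabanLadderNTLinkVarianceFloorPinch` (refined pinch, two
abstract integral bounds).  For a compact group `G` presented by a faithful continuous unitary representation
`ρ : G →* M_N(ℂ)` of positive Lie dimension `D = dimE ρ`, a finite family of staples `k : ι → G` with one-link cost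
`u_k(h) = Σ_i (N − Re tr ρ(h k_i))` and any second finite family `k'` (in the application: a sub-family — the plaquettes of ONE
observable through the link), the Gibbs tilt `e^{−β u_k} dσ` of the Haar probability measure gives the observable `u_{k'}`
VARIANCE AT LEAST `κ/β²`:

  `(κ/β²) ∫ e^{−β u_k} dσ ≤ ∫ (u_{k'} − c)² e^{−β u_k} dσ`   for EVERY real `c`   (`linkCost_variance_floor`),

for all `β ≥ β₀`, whenever (a) both families are `θ/β`-CONSISTENT from a common base point `g₀` (`u_k(g₀), u_{k'}(g₀) ≤ θ/β` — on
the torus: the actual value of the link, typical by the one-point ceiling) and (b) the tilted mean of `u_k` is `≤ C/β` (typical by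
the same ceiling); `κ, β₀ > 0` depend on `(G, ρ, θ, C)` and a bound `m₀` on the two family sizes only — NOT on `β`, not on the
staples.  This is the conditional-variance currency of a TWO-POINT FLOOR: the sequel file runs it through the tree's DLR plumbing
to `c/β² ≤ Var_{T,β}(φ_q)` uniformly in the volume.

Mechanism (no Laplace method, no chart, no criticality of the base point): TWO MASSES — on the Haar ball `r ≤ β^{−1/2}`
(`r = ‖ρ h − ρ g₀‖_F`) the observable is `≤ u_{k'}(g₀) + s₁/β`, on the annulus `ρ₂ β^{−1/2} ≤ r ≤ ρ₃ β^{−1/2}` it is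
`≥ u_{k'}(g₀) + s₂/β` with `s₂ − s₁ ≥ 1` (refined pinch); both regions carry Gibbs weight `≥ p · e^{−β u_k(g₀)} β^{−D/2}` by g9's
two-sided small-ball bounds (`exists_haar_gball_two_sided`, Hilbert–Schmidt balls being left translates), while the normaliser
is `≤ 2 e^{2 m₀ θ} c₂ ρ₄^D · e^{−β u_k(g₀)} β^{−D/2}` (the ball `r ≤ ρ₄ β^{−1/2}` by the small-ball ceiling, its complement by
Markov on hypothesis (b)); whichever side of the midpoint `c` lies, one region is `≥ 1/(2β)` away from it.

HONEST FRAMING.  Finite-dimensional analysis on a compact group, folklore at the Gaussian scale (tree-level lattice perturbation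
theory says `Var ≍ D/(2β²)`); constants not sharp.  A CONDITIONAL variance floor at lattice scale — nothing at NT's physical scale
`a(β)⁻¹`, nothing about the seam or the gap; NT is NOT proved; not Clay.
Refs: Montvay–Münster 1994 §3.2; Chatterjee arXiv:1602.01222 Thm. 2.1/11.1 (small balls); Seiler LNP 159 Ch. 2.
-/

set_option autoImplicit false

noncomputable section

open scoped Matrix Matrix.Norms.Frobenius ENNReal NNReal Topology BigOperators
open MeasureTheory Measure Filter Set Metric
open Literature.MathematicalPhysics.QuantumLattice Literature.MathematicalPhysics.QuantumFieldTheory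
open Summit.QuantumFields.YangMills.Theorems.FreeEnergyLogCoefficient

namespace Summit.QuantumFields.YangMills.Cruxes.NT.LinkEquipartition

/-! ## The one-link variance floor -/

section Floor

variable {N : ℕ} {G : Type*} [Group G] [TopologicalSpace G] [IsTopologicalGroup G] [CompactSpace G]
  [MeasurableSpace G] [BorelSpace G] (ρ : G →* Matrix (Fin N) (Fin N) ℂ)

/-- The numerical gap of the two-mass construction: with `ρ₂ = 4κ₀t + 2t + 3`, `ρ₃ = κ₀ρ₂` (`κ₀ ≥ 1`, `t ≥ 0`),
`1 ≤ ρ₂²/2 − ρ₃ t − (1/2 + t)`. [folklore] -/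
theorem one_le_gap_aux {κ₀ t : ℝ} (hκ₀ : 1 ≤ κ₀) (ht : 0 ≤ t) :
    1 ≤ (4 * κ₀ * t + 2 * t + 3) ^ 2 / 2 - κ₀ * (4 * κ₀ * t + 2 * t + 3) * t - (1 / 2 + t) := by
  have hk0 : 0 ≤ κ₀ := le_trans zero_le_one hκ₀
  nlinarith [mul_nonneg hk0 ht, mul_nonneg (mul_nonneg hk0 ht) ht, mul_nonneg (mul_nonneg hk0 (mul_nonneg hk0 ht)) ht,
    mul_nonneg ht ht]

set_option maxHeartbeats 400000 in
/-- **THE ONE-LINK VARIANCE FLOOR.**  For a compact group with a faithful continuous unitary representation `ρ` of positive Lie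
dimension and every `θ ≥ 0`, `C : ℝ`, `m₀ : ℕ` there are `κ, β₀ > 0` (depending on `(G, ρ, θ, C, m₀)` only) such that for every
`β ≥ β₀`, all finite non-empty staple families `k : ι → G`, `k' : ι' → G` of sizes `≤ m₀`, every base point `g₀` from which both are
`θ/β`-consistent (`u_k(g₀), u_{k'}(g₀) ≤ θ/β`), provided the tilted mean of `u_k` is `≤ C/β`, and EVERY real `c`:
`(κ/β²) ∫ e^{−β u_k} dσ ≤ ∫ (u_{k'} − c)² e^{−β u_k} dσ` — the Gibbs-tilted variance of `u_{k'}` is at least `κ/β²`,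
uniformly in the staples. [folklore] -/
theorem linkCost_variance_floor (hρ : Continuous ρ) (hinj : Function.Injective ρ)
    (hU : ∀ g, ρ g ∈ Matrix.unitaryGroup (Fin N) ℂ) (hD : 0 < dimE ρ) {θ : ℝ} (C : ℝ) (hθ : 0 ≤ θ) (m₀ : ℕ) :
    ∃ κ β₀ : ℝ, 0 < κ ∧ 0 < β₀ ∧ ∀ β : ℝ, β₀ ≤ β →
      ∀ (ι : Type) [Fintype ι] [Nonempty ι] (k : ι → G), Fintype.card ι ≤ m₀ →
      ∀ (ι' : Type) [Fintype ι'] [Nonempty ι'] (k' : ι' → G), Fintype.card ι' ≤ m₀ →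
      ∀ g₀ : G, linkCost ρ k g₀ ≤ θ / β → linkCost ρ k' g₀ ≤ θ / β →
        (∫ h, linkCost ρ k h * Real.exp (-β * linkCost ρ k h) ∂(haarProbability G) ≤
            C / β * ∫ h, Real.exp (-β * linkCost ρ k h) ∂(haarProbability G)) →
        ∀ c : ℝ, κ / β ^ 2 * ∫ h, Real.exp (-β * linkCost ρ k h) ∂(haarProbability G) ≤
          ∫ h, (linkCost ρ k' h - c) ^ 2 * Real.exp (-β * linkCost ρ k h) ∂(haarProbability G) := by
  obtain ⟨δ₀, c₁, c₂, hδ₀, hc₁, hc₂, hball⟩ := exists_haar_gball_two_sided ρ hρ hinj hU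
  -- constants (all depending on `(G, ρ, θ, C, m₀)` only)
  have hD1 : 1 ≤ dimE ρ := Nat.succ_le_of_lt hD
  set D : ℕ := dimE ρ with hDdef
  set t : ℝ := Real.sqrt (2 * θ) with ht
  have ht0 : 0 ≤ t := Real.sqrt_nonneg _
  set κ₀ : ℝ := 2 * c₂ / c₁ + 2 with hκ₀
  have hκ₀1 : 1 ≤ κ₀ := by
    have : 0 ≤ 2 * c₂ / c₁ := div_nonneg (by linarith) hc₁.le
    rw [hκ₀]; linarith
  have hκ₀0 : 0 ≤ κ₀ := le_trans zero_le_one hκ₀1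
  have hκ₀c : c₁ * κ₀ = 2 * c₂ + 2 * c₁ := by rw [hκ₀]; field_simp
  set ρ₂ : ℝ := 4 * κ₀ * t + 2 * t + 3 with hρ₂
  have hρ₂1 : 1 ≤ ρ₂ := by
    have : 0 ≤ 4 * κ₀ * t + 2 * t := by nlinarith
    rw [hρ₂]; linarith
  have hρ₂0 : 0 < ρ₂ := lt_of_lt_of_le one_pos hρ₂1
  set ρ₃ : ℝ := κ₀ * ρ₂ with hρ₃
  have hρ₂₃ : ρ₂ ≤ ρ₃ := by rw [hρ₃]; exact le_mul_of_one_le_left hρ₂0.le hκ₀1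
  have hρ₃0 : 0 < ρ₃ := lt_of_lt_of_le hρ₂0 hρ₂₃
  have hgap0 : 1 ≤ ρ₂ ^ 2 / 2 - ρ₃ * t - (1 / 2 + t) := by
    have h := one_le_gap_aux hκ₀1 ht0
    rw [hρ₃, hρ₂]
    linarith
  set C₁ : ℝ := max C 1 with hC₁
  have hC₁1 : 1 ≤ C₁ := le_max_right _ _
  have hC₁0 : 0 < C₁ := lt_of_lt_of_le one_pos hC₁1
  have hCC₁ : C ≤ C₁ := le_max_left _ _
  set ρ₄ : ℝ := Real.sqrt (8 * C₁ + 8 * θ) + 1 with hρ₄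
  have hρ₄0 : 0 < ρ₄ := by
    have := Real.sqrt_nonneg (8 * C₁ + 8 * θ)
    rw [hρ₄]; linarith
  have hρ₄sq : 8 * C₁ + 8 * θ ≤ ρ₄ ^ 2 := by
    have h1 : Real.sqrt (8 * C₁ + 8 * θ) ^ 2 = 8 * C₁ + 8 * θ := Real.sq_sqrt (by linarith)
    have h2 := Real.sqrt_nonneg (8 * C₁ + 8 * θ)
    rw [hρ₄]; nlinarith
  set M : ℝ := (m₀ : ℝ) with hM
  have hM0 : 0 ≤ M := Nat.cast_nonneg _
  set A₁ : ℝ := M / 2 + M * t with hA₁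
  set A₃ : ℝ := M * (ρ₃ ^ 2 / 2 + ρ₃ * t) with hA₃
  set p : ℝ := min (Real.exp (-A₁) * c₁) (Real.exp (-A₃) * c₂ * ρ₂ ^ D) with hp
  have hp0 : 0 < p :=
    lt_min (mul_pos (Real.exp_pos _) hc₁) (mul_pos (mul_pos (Real.exp_pos _) hc₂) (pow_pos hρ₂0 _))
  have hp1 : p ≤ Real.exp (-A₁) * c₁ := min_le_left _ _
  have hp2 : p ≤ Real.exp (-A₃) * c₂ * ρ₂ ^ D := min_le_right _ _
  set Q : ℝ := 2 * Real.exp (2 * M * θ) * c₂ * ρ₄ ^ D with hQ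
  have hQ0 : 0 < Q := mul_pos (mul_pos (mul_pos two_pos (Real.exp_pos _)) hc₂) (pow_pos hρ₄0 _)
  set κ : ℝ := p / (4 * Q) with hκ
  have hκ0 : 0 < κ := div_pos hp0 (by linarith)
  have hκQ : κ * Q = p / 4 := by rw [hκ]; field_simp
  set β₀ : ℝ := max 1 (max (ρ₃ ^ 2 / δ₀ ^ 2) (ρ₄ ^ 2 / δ₀ ^ 2)) with hβ₀
  have hβ₀1 : 1 ≤ β₀ := le_max_left _ _
  refine ⟨κ, β₀, hκ0, lt_of_lt_of_le one_pos hβ₀1, ?_⟩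
  intro β hβ ι _ _ k hk ι' _ _ k' hk' g₀ hu₀ hu₀' hmean c
  have hβ1 : 1 ≤ β := hβ₀1.trans hβ
  have hβ0 : 0 < β := lt_of_lt_of_le one_pos hβ1
  -- the Gaussian scale `δ = 1/√β`
  set δ : ℝ := 1 / Real.sqrt β with hδ
  have hsβ : 0 < Real.sqrt β := Real.sqrt_pos.2 hβ0
  have hδ0 : 0 < δ := div_pos one_pos hsβ
  have hδsq : δ ^ 2 = 1 / β := by rw [hδ, one_div, inv_pow, Real.sq_sqrt hβ0.le, one_div]
  have hδD : 0 < δ ^ D := pow_pos hδ0 _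
  have hρδ : ∀ {ρ' : ℝ}, 0 < ρ' → ρ' ^ 2 / δ₀ ^ 2 ≤ β → ρ' * δ ≤ δ₀ := by
    intro ρ' hρ' hle
    have hle' : ρ' ^ 2 ≤ β * δ₀ ^ 2 := (div_le_iff₀ (pow_pos hδ₀ 2)).1 hle
    have h1 : (ρ' * δ) ^ 2 ≤ δ₀ ^ 2 := by
      rw [mul_pow, hδsq, mul_one_div, div_le_iff₀ hβ0]
      linarith
    exact (pow_le_pow_iff_left₀ (mul_pos hρ' hδ0).le hδ₀.le two_ne_zero).1 h1
  have hρ₃δ : ρ₃ * δ ≤ δ₀ := hρδ hρ₃0 ((le_max_left _ _).trans ((le_max_right _ _).trans hβ))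
  have hρ₄δ : ρ₄ * δ ≤ δ₀ := hρδ hρ₄0 ((le_max_right _ _).trans ((le_max_right _ _).trans hβ))
  have hρ₂δ : ρ₂ * δ ≤ δ₀ := (mul_le_mul_of_nonneg_right hρ₂₃ hδ0.le).trans hρ₃δ
  have h1δ : δ ≤ δ₀ := (le_mul_of_one_le_left hδ0.le hρ₂1).trans hρ₂δ
  -- sizes
  set σ := haarProbability G with hσ
  set m : ℝ := (Fintype.card ι : ℝ) with hm
  set m' : ℝ := (Fintype.card ι' : ℝ) with hm'
  have hm1 : 1 ≤ m := by rw [hm]; exact_mod_cast Fintype.card_pos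
  have hm'1 : 1 ≤ m' := by rw [hm']; exact_mod_cast Fintype.card_pos
  have hmM : m ≤ M := by rw [hm, hM]; exact_mod_cast hk
  have hm'M : m' ≤ M := by rw [hm', hM]; exact_mod_cast hk'
  have hm0 : 0 ≤ m := le_trans zero_le_one hm1
  have hm'0 : 0 ≤ m' := le_trans zero_le_one hm'1
  -- the costs, the chord, the weight
  set u := linkCost ρ k with hu
  set u' := linkCost ρ k' with hu'
  set u₀ := u g₀ with hu₀def
  set u₀' := u' g₀ with hu₀'def
  have hucont : Continuous u := continuous_linkCost ρ hρ k
  have hu'cont : Continuous u' := continuous_linkCost ρ hρ k'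
  have hunn : ∀ h, 0 ≤ u h := linkCost_nonneg ρ hU k
  have hu₀0 : 0 ≤ u₀ := hunn g₀
  set r : G → ℝ := fun h => ‖ρ h - ρ g₀‖ with hr
  have hrcont : Continuous r := (hρ.sub continuous_const).norm
  have hr0 : ∀ h, 0 ≤ r h := fun h => norm_nonneg _
  have hP : ∀ h, u₀ + m / 2 * r h ^ 2 - m * r h * (t * δ) ≤ u h ∧ u h ≤ u₀ + m / 2 * r h ^ 2 + m * r h * (t * δ) ∧
      u₀ + m / 4 * r h ^ 2 - 2 * m * θ / β ≤ u h :=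
    fun h => linkCost_pinch_of_consistent ρ hU k g₀ hβ0 hθ hu₀ h
  have hP' : ∀ h, u₀' + m' / 2 * r h ^ 2 - m' * r h * (t * δ) ≤ u' h ∧
      u' h ≤ u₀' + m' / 2 * r h ^ 2 + m' * r h * (t * δ) :=
    fun h => ⟨(linkCost_pinch_of_consistent ρ hU k' g₀ hβ0 hθ hu₀' h).1,
      (linkCost_pinch_of_consistent ρ hU k' g₀ hβ0 hθ hu₀' h).2.1⟩
  set w : G → ℝ := fun h => Real.exp (-β * u h) with hw
  have hwpos : ∀ h, 0 < w h := fun h => Real.exp_pos _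
  have hwcont : Continuous w := Real.continuous_exp.comp (continuous_const.mul hucont)
  have hint : ∀ {f : G → ℝ}, Continuous f → Integrable f σ := fun hf =>
    hf.integrable_of_hasCompactSupport (HasCompactSupport.of_compactSpace _)
  have hwint : Integrable w σ := hint hwcont
  have huwint : Integrable (fun h => u h * w h) σ := hint (hucont.mul hwcont)
  have hFint : Integrable (fun h => (u' h - c) ^ 2 * w h) σ := hint (((hu'cont.sub continuous_const).pow 2).mul hwcont)
  set E₀ : ℝ := Real.exp (-β * u₀) with hE₀
  have hE₀0 : 0 < E₀ := Real.exp_pos _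
  have hwexp : ∀ h {A : ℝ}, β * u h ≤ β * u₀ + A → E₀ * Real.exp (-A) ≤ w h := by
    intro h A hA
    rw [hE₀, ← Real.exp_add]
    exact Real.exp_le_exp.2 (by linarith)
  have hwexp' : ∀ h {A : ℝ}, β * u₀ - A ≤ β * u h → w h ≤ E₀ * Real.exp A := by
    intro h A hA
    rw [hE₀, ← Real.exp_add]
    exact Real.exp_le_exp.2 (by linarith)
  set Z := ∫ h, w h ∂σ with hZ
  have hZ0 : 0 ≤ Z := integral_nonneg fun h => (hwpos h).le
  have hmean' : ∫ h, u h * w h ∂σ ≤ C / β * Z := hmean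
  show κ / β ^ 2 * Z ≤ ∫ h, (u' h - c) ^ 2 * w h ∂σ
  -- regions
  set R₁ : Set G := {h | r h ≤ δ} with hR₁
  set R₂ : Set G := {h | ρ₂ * δ ≤ r h ∧ r h ≤ ρ₃ * δ} with hR₂
  set Rn : Set G := {h | r h ≤ ρ₄ * δ} with hRn
  have hR₁m : MeasurableSet R₁ := (isClosed_le hrcont continuous_const).measurableSet
  have hR₂m : MeasurableSet R₂ :=
    ((isClosed_le continuous_const hrcont).inter (isClosed_le hrcont continuous_const)).measurableSet
  have hRnm : MeasurableSet Rn := (isClosed_le hrcont continuous_const).measurableSet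
  -- Haar measures of the regions (Hilbert–Schmidt balls are left translates of balls at `1`)
  have hballg : ∀ a : ℝ, 0 < a → a ≤ δ₀ →
      c₁ * a ^ D ≤ σ.real {h | r h ≤ a} ∧ σ.real {h | r h ≤ a} ≤ c₂ * a ^ D := by
    intro a ha hale
    have e : σ.real {h | r h ≤ a} = σ.real {g : G | ‖ρ g - 1‖ ≤ a} := by
      rw [measureReal_def, measureReal_def]
      exact congrArg ENNReal.toReal (haar_setOf_norm_sub_le ρ hU g₀ a)
    rw [e]; exact hball a ha hale
  have hσR₁ : c₁ * δ ^ D ≤ σ.real R₁ := (hballg δ hδ0 h1δ).1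
  have hσR₂ : c₂ * ρ₂ ^ D * δ ^ D ≤ σ.real R₂ := by
    have hsub : {h | r h ≤ ρ₃ * δ} ⊆ R₂ ∪ {h | r h ≤ ρ₂ * δ} := by
      intro h hh
      by_cases h2 : ρ₂ * δ ≤ r h
      · exact Or.inl ⟨h2, hh⟩
      · exact Or.inr (le_of_lt (not_le.1 h2))
    have h3 := (hballg (ρ₃ * δ) (mul_pos hρ₃0 hδ0) hρ₃δ).1
    have h2 := (hballg (ρ₂ * δ) (mul_pos hρ₂0 hδ0) hρ₂δ).2
    rw [mul_pow] at h3 h2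
    have hun := (measureReal_mono (μ := σ) hsub).trans (measureReal_union_le R₂ {h | r h ≤ ρ₂ * δ})
    have hκD : κ₀ ≤ κ₀ ^ D := by
      calc κ₀ = κ₀ ^ 1 := (pow_one κ₀).symm
        _ ≤ κ₀ ^ D := pow_le_pow_right₀ hκ₀1 hD1
    have hρD : 0 ≤ ρ₂ ^ D := (pow_pos hρ₂0 _).le
    have h5 : 2 * c₂ + 2 * c₁ ≤ c₁ * κ₀ ^ D := by
      calc 2 * c₂ + 2 * c₁ = c₁ * κ₀ := hκ₀c.symm
        _ ≤ c₁ * κ₀ ^ D := mul_le_mul_of_nonneg_left hκD hc₁.le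
    have h6 := mul_le_mul_of_nonneg_right (mul_le_mul_of_nonneg_right h5 hρD) hδD.le
    have h7 : 0 ≤ c₁ * ρ₂ ^ D * δ ^ D := mul_nonneg (mul_nonneg hc₁.le hρD) hδD.le
    have e : ρ₃ ^ D = κ₀ ^ D * ρ₂ ^ D := by rw [hρ₃, mul_pow]
    rw [e] at h3
    linarith only [h3, h2, hun, h6, h7]
  have hσRn : σ.real Rn ≤ c₂ * ρ₄ ^ D * δ ^ D := by
    have := (hballg (ρ₄ * δ) (mul_pos hρ₄0 hδ0) hρ₄δ).2
    rw [mul_pow, ← mul_assoc] at this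
    exact this
  -- the observable on the two regions
  set s₁ : ℝ := m' / 2 + m' * t with hs₁
  set s₂ : ℝ := m' * (ρ₂ ^ 2 / 2 - ρ₃ * t) with hs₂
  have hgap : s₁ + 1 ≤ s₂ := by
    have e : s₂ - s₁ = m' * (ρ₂ ^ 2 / 2 - ρ₃ * t - (1 / 2 + t)) := by rw [hs₁, hs₂]; ring
    have h5 : 1 * 1 ≤ m' * (ρ₂ ^ 2 / 2 - ρ₃ * t - (1 / 2 + t)) := mul_le_mul hm'1 hgap0 zero_le_one hm'0
    linarith only [e, h5]
  have huR₁ : ∀ h ∈ R₁, u' h ≤ u₀' + s₁ / β := by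
    intro h hh
    have hrh : r h ≤ δ := hh
    have hr2 : r h ^ 2 ≤ δ ^ 2 := pow_le_pow_left₀ (hr0 h) hrh 2
    have h5 : m' * r h * (t * δ) ≤ m' * δ * (t * δ) :=
      mul_le_mul_of_nonneg_right (mul_le_mul_of_nonneg_left hrh hm'0) (mul_nonneg ht0 hδ0.le)
    have h6 : m' / 2 * r h ^ 2 ≤ m' / 2 * δ ^ 2 := mul_le_mul_of_nonneg_left hr2 (by linarith only [hm'0])
    have e : (m' / 2 + m' * t) * δ ^ 2 = s₁ / β := by rw [hs₁, hδsq]; ring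
    linarith only [(hP' h).2, h5, h6, e]
  have huR₂ : ∀ h ∈ R₂, u₀' + s₂ / β ≤ u' h := by
    intro h hh
    have hlo : ρ₂ * δ ≤ r h := hh.1
    have hhi : r h ≤ ρ₃ * δ := hh.2
    have hr2 : (ρ₂ * δ) ^ 2 ≤ r h ^ 2 := pow_le_pow_left₀ (mul_pos hρ₂0 hδ0).le hlo 2
    have h5 : m' * r h * (t * δ) ≤ m' * (ρ₃ * δ) * (t * δ) :=
      mul_le_mul_of_nonneg_right (mul_le_mul_of_nonneg_left hhi hm'0) (mul_nonneg ht0 hδ0.le)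
    have h6 : m' / 2 * (ρ₂ * δ) ^ 2 ≤ m' / 2 * r h ^ 2 := mul_le_mul_of_nonneg_left hr2 (by linarith only [hm'0])
    have e : m' * (ρ₂ ^ 2 / 2 - ρ₃ * t) * δ ^ 2 = s₂ / β := by rw [hs₂, hδsq]; ring
    linarith only [(hP' h).1, h5, h6, e]
  -- the weight on the two regions and on the near ball
  have hwR₁ : ∀ h ∈ R₁, E₀ * Real.exp (-A₁) ≤ w h := by
    intro h hh
    have hrh : r h ≤ δ := hh
    have hr2 : r h ^ 2 ≤ δ ^ 2 := pow_le_pow_left₀ (hr0 h) hrh 2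
    have h5 : m * r h * (t * δ) ≤ m * δ * (t * δ) :=
      mul_le_mul_of_nonneg_right (mul_le_mul_of_nonneg_left hrh hm0) (mul_nonneg ht0 hδ0.le)
    have h6 : m / 2 * r h ^ 2 ≤ m / 2 * δ ^ 2 := mul_le_mul_of_nonneg_left hr2 (by linarith only [hm0])
    have h7 : m * t ≤ M * t := mul_le_mul_of_nonneg_right hmM ht0
    refine hwexp h ?_
    have hb : u h ≤ u₀ + (m / 2 + m * t) * δ ^ 2 := by linarith only [(hP h).2.1, h5, h6]
    have h8 := mul_le_mul_of_nonneg_left hb hβ0.le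
    have e : β * (u₀ + (m / 2 + m * t) * δ ^ 2) = β * u₀ + (m / 2 + m * t) := by
      rw [hδsq]; field_simp
    rw [hA₁]
    linarith only [h8, e, h7, hmM]
  have hwR₂ : ∀ h ∈ R₂, E₀ * Real.exp (-A₃) ≤ w h := by
    intro h hh
    have hrh : r h ≤ ρ₃ * δ := hh.2
    have hr2 : r h ^ 2 ≤ (ρ₃ * δ) ^ 2 := pow_le_pow_left₀ (hr0 h) hrh 2
    have h5 : m * r h * (t * δ) ≤ m * (ρ₃ * δ) * (t * δ) :=
      mul_le_mul_of_nonneg_right (mul_le_mul_of_nonneg_left hrh hm0) (mul_nonneg ht0 hδ0.le)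
    have h6 : m / 2 * r h ^ 2 ≤ m / 2 * (ρ₃ * δ) ^ 2 := mul_le_mul_of_nonneg_left hr2 (by linarith only [hm0])
    have h7 : m * (ρ₃ ^ 2 / 2 + ρ₃ * t) ≤ M * (ρ₃ ^ 2 / 2 + ρ₃ * t) :=
      mul_le_mul_of_nonneg_right hmM (by nlinarith only [hρ₃0, ht0])
    refine hwexp h ?_
    have hb : u h ≤ u₀ + m * (ρ₃ ^ 2 / 2 + ρ₃ * t) * δ ^ 2 := by linarith only [(hP h).2.1, h5, h6]
    have h8 := mul_le_mul_of_nonneg_left hb hβ0.le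
    have e : β * (u₀ + m * (ρ₃ ^ 2 / 2 + ρ₃ * t) * δ ^ 2) = β * u₀ + m * (ρ₃ ^ 2 / 2 + ρ₃ * t) := by
      rw [hδsq]; field_simp
    rw [hA₃]
    linarith only [h8, e, h7]
  have hwRn : ∀ h ∈ Rn, w h ≤ E₀ * Real.exp (2 * M * θ) := by
    intro h _
    refine hwexp' h ?_
    have h5 : 2 * m * θ ≤ 2 * M * θ := mul_le_mul_of_nonneg_right (by linarith only [hmM]) hθ
    have h6 : 0 ≤ m / 4 * r h ^ 2 := mul_nonneg (by linarith only [hm0]) (sq_nonneg _)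
    have hb : u₀ - 2 * m * θ / β ≤ u h := by linarith only [(hP h).2.2, h6]
    have h8 := mul_le_mul_of_nonneg_left hb hβ0.le
    have e : β * (u₀ - 2 * m * θ / β) = β * u₀ - 2 * m * θ := by field_simp
    linarith only [h8, e, h5]
  have hwfar : ∀ h ∈ Rnᶜ, w h ≤ β / (2 * C₁) * (u h * w h) := by
    intro h hh
    have hrh : ρ₄ * δ < r h := not_le.1 hh
    have hr2 : (ρ₄ * δ) ^ 2 ≤ r h ^ 2 := pow_le_pow_left₀ (mul_pos hρ₄0 hδ0).le hrh.le 2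
    have hlow : 2 * C₁ / β ≤ u h := by
      have h7 : m / 4 * (ρ₄ * δ) ^ 2 ≤ m / 4 * r h ^ 2 := mul_le_mul_of_nonneg_left hr2 (by linarith only [hm0])
      have h6 : 2 * C₁ ≤ ρ₄ ^ 2 / 4 - 2 * θ := by linarith only [hρ₄sq]
      have h9 : 1 * (2 * C₁) ≤ m * (ρ₄ ^ 2 / 4 - 2 * θ) := mul_le_mul hm1 h6 (by linarith only [hC₁0]) hm0
      have e1 : m * (ρ₄ ^ 2 / 4 - 2 * θ) * δ ^ 2 = m / 4 * (ρ₄ * δ) ^ 2 - 2 * m * θ / β := by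
        rw [mul_pow, hδsq]; ring
      have e2 : 2 * C₁ / β = 2 * C₁ * δ ^ 2 := by rw [hδsq]; ring
      have h10 : 2 * C₁ * δ ^ 2 ≤ m * (ρ₄ ^ 2 / 4 - 2 * θ) * δ ^ 2 :=
        mul_le_mul_of_nonneg_right (by linarith only [h9]) (sq_nonneg _)
      linarith only [(hP h).2.2, h7, e1, e2, h10, hu₀0]
    have h1 : 1 ≤ β / (2 * C₁) * u h := by
      rw [div_mul_eq_mul_div, le_div_iff₀ (by linarith only [hC₁0])]
      have h5 := mul_le_mul_of_nonneg_left hlow hβ0.le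
      have e : β * (2 * C₁ / β) = 2 * C₁ := by field_simp
      linarith only [h5, e]
    calc w h = 1 * w h := (one_mul _).symm
      _ ≤ β / (2 * C₁) * u h * w h := mul_le_mul_of_nonneg_right h1 (hwpos h).le
      _ = β / (2 * C₁) * (u h * w h) := by ring
  -- the normaliser
  have hZle : Z ≤ Q * (E₀ * δ ^ D) := by
    have h1 : Z ≤ E₀ * Real.exp (2 * M * θ) * σ.real Rn + β / (2 * C₁) * ∫ h, u h * w h ∂σ :=
      integral_le_near_add_far σ hRnm hwint huwint (fun h => (hwpos h).le) hunn
        (div_nonneg hβ0.le (by linarith only [hC₁0])) hwRn hwfar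
    have h2 : β / (2 * C₁) * ∫ h, u h * w h ∂σ ≤ Z / 2 := by
      have h3 : C / β * Z ≤ C₁ / β * Z := mul_le_mul_of_nonneg_right (div_le_div_of_nonneg_right hCC₁ hβ0.le) hZ0
      have h4 : β / (2 * C₁) * ∫ h, u h * w h ∂σ ≤ β / (2 * C₁) * (C₁ / β * Z) :=
        mul_le_mul_of_nonneg_left (hmean'.trans h3) (div_nonneg hβ0.le (by linarith only [hC₁0]))
      have e : β / (2 * C₁) * (C₁ / β * Z) = Z / 2 := by field_simp
      linarith only [h4, e]
    have h5 : E₀ * Real.exp (2 * M * θ) * σ.real Rn ≤ E₀ * Real.exp (2 * M * θ) * (c₂ * ρ₄ ^ D * δ ^ D) :=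
      mul_le_mul_of_nonneg_left hσRn (mul_pos hE₀0 (Real.exp_pos _)).le
    have e : E₀ * Real.exp (2 * M * θ) * (c₂ * ρ₄ ^ D * δ ^ D) = Q * (E₀ * δ ^ D) / 2 := by rw [hQ]; ring
    linarith only [h1, h2, h5, e]
  -- two masses
  have hgap' : u₀' + s₁ / β + 2 * (1 / (2 * β)) ≤ u₀' + s₂ / β := by
    have h1 : (s₁ + 1) / β ≤ s₂ / β := div_le_div_of_nonneg_right hgap hβ0.le
    rw [add_div] at h1
    have e : 2 * (1 / (2 * β)) = 1 / β := by field_simp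
    linarith only [h1, e]
  have hmass := sq_mul_min_le_integral_sq_sub_mul σ c hR₁m hR₂m hFint (fun h => (hwpos h).le) huR₁ huR₂
    (q := 1 / (2 * β)) (div_pos one_pos (by linarith only [hβ0])).le hgap' hwR₁ hwR₂
    (mul_pos hE₀0 (Real.exp_pos _)).le (mul_pos hE₀0 (Real.exp_pos _)).le
  have hmin : E₀ * (p * δ ^ D) ≤ min (E₀ * Real.exp (-A₁) * σ.real R₁) (E₀ * Real.exp (-A₃) * σ.real R₂) := by
    refine le_min ?_ ?_
    · have h1 : p * δ ^ D ≤ Real.exp (-A₁) * σ.real R₁ := by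
        calc p * δ ^ D ≤ Real.exp (-A₁) * c₁ * δ ^ D := mul_le_mul_of_nonneg_right hp1 hδD.le
          _ = Real.exp (-A₁) * (c₁ * δ ^ D) := by ring
          _ ≤ Real.exp (-A₁) * σ.real R₁ := mul_le_mul_of_nonneg_left hσR₁ (Real.exp_pos _).le
      have := mul_le_mul_of_nonneg_left h1 hE₀0.le
      linarith only [this, mul_assoc E₀ (Real.exp (-A₁)) (σ.real R₁)]
    · have h1 : p * δ ^ D ≤ Real.exp (-A₃) * σ.real R₂ := by
        calc p * δ ^ D ≤ Real.exp (-A₃) * c₂ * ρ₂ ^ D * δ ^ D := mul_le_mul_of_nonneg_right hp2 hδD.le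
          _ = Real.exp (-A₃) * (c₂ * ρ₂ ^ D * δ ^ D) := by ring
          _ ≤ Real.exp (-A₃) * σ.real R₂ := mul_le_mul_of_nonneg_left hσR₂ (Real.exp_pos _).le
      have := mul_le_mul_of_nonneg_left h1 hE₀0.le
      linarith only [this, mul_assoc E₀ (Real.exp (-A₃)) (σ.real R₂)]
  -- conclusion
  have hfin : κ / β ^ 2 * Z ≤ (1 / (2 * β)) ^ 2 * (E₀ * (p * δ ^ D)) := by
    have h1 : κ / β ^ 2 * Z ≤ κ / β ^ 2 * (Q * (E₀ * δ ^ D)) :=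
      mul_le_mul_of_nonneg_left hZle (div_nonneg hκ0.le (sq_nonneg _))
    have e : κ / β ^ 2 * (Q * (E₀ * δ ^ D)) = (1 / (2 * β)) ^ 2 * (E₀ * (p * δ ^ D)) := by
      have e1 : κ / β ^ 2 * (Q * (E₀ * δ ^ D)) = κ * Q * (E₀ * δ ^ D) / β ^ 2 := by ring
      rw [e1, hκQ]
      field_simp
      ring
    linarith only [h1, e]
  have hq0 : 0 ≤ (1 / (2 * β)) ^ 2 := sq_nonneg _
  exact hfin.trans ((mul_le_mul_of_nonneg_left hmin hq0).trans hmass)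

end Floor

end Summit.QuantumFields.YangMills.Cruxes.NT.LinkEquipartition

end
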